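import Literature.NumberTheory.Rogawski1990.ArchBouazizStableFamilyJumpZeroProduct    -- ★ p850334 (this seat): (P1)∕(P4)-discharged product jump; brings ★ p850206, (T-CONGR), (K0±-Cayley∕Stable)
import HarnessLib

/-!
# (J-H) ORDER 0 WITH THE RANK-ONE CONSTANT AS A BINDER — the (K0±-Cayley) constant `C₁` enters as a variable with its defining jump property as a hypothesis
# (Shelstad 1979 Lemma 4.3, Thm. 4.7 (IIIb); Bouaziz 1994 §3.2 (I₃), §6.2; Rogawski 1990 §8.2)

Topic `NumberTheory/Rogawski1990`; namespace `Literature.NumberTheory.Rogawski1990`.  THEOREMS ONLY (no `def`, no instance, no notation, no axiom, no named fact, no `sorry`).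
Cell `pub/hodgecm-mathlib`, line LH3 (closer stub `stub_N9`, crux H413 = `stmt-HodgeConjecture-24833`), DIRECT ROAD organ J; brick **(K0H-BINDER)** of the H-SIDE HEAD
(LH4-p03 (g4) (J-JOIN) 2026-09-02T08:04:11Z: «make `bookH` a CLOSED TERM over NAMED constants — constant as a binder + its defining property as a hypothesis, NOT
`Classical.choose` of an `∃ C` inside your proof», so that (J-BOOK) reduces to a rank-one ratio of named constants); author LH10-p02 (g4).  Count-neutral.

WHAT IS PROVED — the twins of ★ p850206 `exists_hasOneSidedJump_stOrbFamH_add_smul_nrm` and ★ p850334 `exists_hasOneSidedJump_stOrbFamH_add_smul_nrm_prod` in which the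
`∃ C₁ > 0` (obtained there from ★ (K0±-Cayley) p850055 through ★ p850182) is replaced by a BINDER `C₁ : ℝ` carrying the (K0±-Cayley) jump property at `(w₀, ν₀)` as a HYPOTHESIS
`hK0 : ∀ f ∈ C_c(M₂(ℂ)), ∀ z ∈ S¹, HasOneSidedJump (ψ ↦ 2 sin ψ · ∫_{U(Φ₂)_{w₀}} f(h·(P diag(z e^{iψ}, z e^{−iψ}) P⁻¹)·h⁻¹) dν₀) (C₁ · [cone⁺ + cone⁻](f, z))` (★ p850055's body
VERBATIM; the stable doubling ★ `HasOneSidedJump.stableSum_of_two_sin_mul` supplies ★ p850182's shape):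
* §1 `hasOneSidedJump_stOrbFamH_add_smul_nrm_of_cayleyJump (C₁) (hK0)` — the by-statement jump VALUE (`hP`, `hG1`, `κ`, `hQ` as in ★ p850206), same proof;
* §2 `hasOneSidedJump_stOrbFamH_add_smul_nrm_prod_of_cayleyJump (C₁) (hK0)` — the product-road jump VALUE, binder-free except for `C₁` (★ p850334 §2's proof).
The H-SIDE HEAD then books `bookH S w₀ = 2 · I · C₁(w₀) ∕ D(w₀)` with `D` the (A0-DOCKED) constant of ★ p850415, both NAMED.
HONEST LABEL: HC_CM is proved only modulo the 7 printed citations (2 remaining: hLiu418 = `stmt-HodgeConjecture-24832`, h413 = `stmt-HodgeConjecture-24833`) until rung 0 closes;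
count-neutral.

## References
* [Shelstad1979] D. Shelstad, *Characters and inner forms of a quasi-split group over ℝ*, Compositio Math. 39 (1979), Lemma 4.3 p. 25, Thm. 4.7 (IIIb) p. 31.
* [Bouaziz1994IntegralesOrbitales] A. Bouaziz, *Intégrales orbitales sur les groupes de Lie réductifs*, Ann. Sci. ÉNS 27 (1994), §3.2 (I₃) p. 580, §6.2 p. 591.
* [Rogawski1990] J. D. Rogawski, *Automorphic Representations of Unitary Groups in Three Variables*, Ann. of Math. Stud. 123 (1990), §8.2 pp. 119, 122, §8.3 p. 124.
* [BorelJacquet1979] A. Borel, H. Jacquet, *Automorphic forms and automorphic representations*, PSPM 33.1 (1979), §4.1.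
-/

set_option autoImplicit false

noncomputable section

open Filter Topology MeasureTheory NumberField NumberField.InfinitePlace Complex Set Function Real
open Literature.NumberTheory.Automorphic Literature.NumberTheory.Automorphic.UnitaryGroup Literature.NumberTheory.Automorphic.ArchCartan
open Literature.NumberTheory.Automorphic.Shelstad1979.StableOrbitalIntegrals
open scoped MatrixGroups

namespace Literature.NumberTheory.Rogawski1990

/-! ## §1 The by-statement jump value with `C₁` as a binder (twin of ★ p850206) -/

section JumpBinder

open scoped Classical

variable (L : Type) [Field L] [NumberField L] [IsCMField L]
  [MeasurableSpace (↥(arch (↥(maximalRealSubfield L)) L (IsCMField.complexConj L) 2 (Matrix.of fun i j : Fin 2 => if i.val + j.val + 1 = 2 then (1 : L) else 0)) ×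
      ↥(arch (↥(maximalRealSubfield L)) L (IsCMField.complexConj L) 1 (Matrix.of fun i j : Fin 1 => if i.val + j.val + 1 = 1 then (1 : L) else 0)))]
  [BorelSpace (↥(arch (↥(maximalRealSubfield L)) L (IsCMField.complexConj L) 2 (Matrix.of fun i j : Fin 2 => if i.val + j.val + 1 = 2 then (1 : L) else 0)) ×
      ↥(arch (↥(maximalRealSubfield L)) L (IsCMField.complexConj L) 1 (Matrix.of fun i j : Fin 1 => if i.val + j.val + 1 = 1 then (1 : L) else 0)))]
  (νH : Measure (↥(arch (↥(maximalRealSubfield L)) L (IsCMField.complexConj L) 2 (Matrix.of fun i j : Fin 2 => if i.val + j.val + 1 = 2 then (1 : L) else 0)) ×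
      ↥(arch (↥(maximalRealSubfield L)) L (IsCMField.complexConj L) 1 (Matrix.of fun i j : Fin 1 => if i.val + j.val + 1 = 1 then (1 : L) else 0))))
  [IsFiniteMeasureOnCompacts νH] [νH.IsMulRightInvariant]
  (w₀ : {w : InfinitePlace L // IsComplex w})
  [MeasurableSpace (archLocal L 2 (Matrix.of fun i j : Fin 2 => if i.val + j.val + 1 = 2 then (1 : L) else 0) w₀)]
  (ν₀ : Measure (archLocal L 2 (Matrix.of fun i j : Fin 2 => if i.val + j.val + 1 = 2 then (1 : L) else 0) w₀))

/-- **(J-H) ORDER 0 — THE JUMP VALUE, `C₁` AS A BINDER.**  For every real `C₁` with the (K0±-Cayley) jump property at `(w₀, ν₀)` (`hK0`, ★ p850055's conclusion for this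
`C₁`) and every `fH` whose chart functional on `S ∌ w₀` has the product reading `hP` with `G` reading slot `1` only (`hG1`) and the `w₀`-functional read on the Cayley torus
(`hQ`, constant `κ`), the stable orbital family along the normal curve of the wall at a semiregular point `s` JUMPS BY
`G s · (∏_{w ≠ w₀} L_w(s w)) · (κ · 2i · C₁ · [cone⁺ + cone⁻](f₀, e^{i s₀}))` — ★ p850206 with the constant named. [cite: Shelstad1979, Lemma 4.3 p. 25; Thm. 4.7 (IIIb) p. 31]
[cite: Bouaziz1994IntegralesOrbitales, §3.2 (I₃) p. 580; §6.2 p. 591] [cite: Rogawski1990, §8.2 pp. 119, 122] -/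
theorem hasOneSidedJump_stOrbFamH_add_smul_nrm_of_cayleyJump (C₁ : ℝ)
    (hK0 : ∀ (f : Matrix (Fin 2) (Fin 2) ℂ → ℂ), Continuous f → HasCompactSupport f → ∀ z : Circle,
          HasOneSidedJump (fun ψ : ℝ => (2 * Real.sin ψ : ℂ) *
              ∫ h : archLocal L 2 (Matrix.of fun i j : Fin 2 => if i.val + j.val + 1 = 2 then (1 : L) else 0) w₀,
                f (((h * ⟨Matrix.GeneralLinearGroup.mkOfDetNeZero !![(1 : ℂ), 1; 1, -1] det_cayleyTwo_ne_zero *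
                      circleDiagonal 2 ![z * Circle.exp ψ, z * Circle.exp (-ψ)] *
                      (Matrix.GeneralLinearGroup.mkOfDetNeZero !![(1 : ℂ), 1; 1, -1] det_cayleyTwo_ne_zero)⁻¹,
                    cayley_conj_circleDiagonal_mem_archLocal L w₀ _⟩ * h⁻¹ :
                  archLocal L 2 (Matrix.of fun i j : Fin 2 => if i.val + j.val + 1 = 2 then (1 : L) else 0) w₀) : GL (Fin 2) ℂ) : Matrix (Fin 2) (Fin 2) ℂ) ∂ν₀)
            ((C₁ : ℂ) * ((∫ p in Ioi (0 : ℝ) ×ˢ Ioc (0 : ℝ) (2 * π),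
                f ((!![(1 : ℂ), 1; 1, -1] : Matrix (Fin 2) (Fin 2) ℂ) *
                  ((z : ℂ) • (1 : Matrix (Fin 2) (Fin 2) ℂ) + p.1 • Matrix.diagonal ![(z : ℂ) * I, -((z : ℂ) * I)] +
                    p.1 • !![(0 : ℂ), -((z : ℂ) * I) * cexp (-((p.2 : ℂ) * I)); ((z : ℂ) * I) * cexp ((p.2 : ℂ) * I), 0]) *
                  !![(1 / 2 : ℂ), 1 / 2; 1 / 2, -(1 / 2)])) +
              ∫ p in Ioi (0 : ℝ) ×ˢ Ioc (0 : ℝ) (2 * π),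
                f ((!![(1 : ℂ), 1; 1, -1] : Matrix (Fin 2) (Fin 2) ℂ) *
                  ((z : ℂ) • (1 : Matrix (Fin 2) (Fin 2) ℂ) + p.1 • Matrix.diagonal ![-((z : ℂ) * I), (z : ℂ) * I] +
                    p.1 • !![(0 : ℂ), ((z : ℂ) * I) * cexp (-((p.2 : ℂ) * I)); -((z : ℂ) * I) * cexp ((p.2 : ℂ) * I), 0]) *
                  !![(1 / 2 : ℂ), 1 / 2; 1 / 2, -(1 / 2)])))) :
      ∀ (fH : ↥(arch (↥(maximalRealSubfield L)) L (IsCMField.complexConj L) 2 (Matrix.of fun i j : Fin 2 => if i.val + j.val + 1 = 2 then (1 : L) else 0)) ×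
          ↥(arch (↥(maximalRealSubfield L)) L (IsCMField.complexConj L) 1 (Matrix.of fun i j : Fin 1 => if i.val + j.val + 1 = 1 then (1 : L) else 0)) → ℂ)
        (S : Finset {w : InfinitePlace L // IsComplex w}) (_ : w₀ ∉ S)
        (s : {w : InfinitePlace L // IsComplex w} → Fin 3 → ℝ) (_ : s w₀ 0 = s w₀ 2)
        (_ : ∀ w, w ∉ S → w ≠ w₀ → Circle.exp (s w 0) ≠ Circle.exp (s w 2)) (_ : ∀ w ∈ S, s w 0 ≠ 0)
        (G : ({w : InfinitePlace L // IsComplex w} → Fin 3 → ℝ) → ℂ) (φ : {w : InfinitePlace L // IsComplex w} → (Fin 3 → ℝ) → ℂ)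
        (_ : ∀ c ∈ RegS S, chartOrbH L νH S fH c = G c * ∏ w, φ w (c w))
        (_ : ∀ c c' : {w : InfinitePlace L // IsComplex w} → Fin 3 → ℝ, (∀ w, c w 1 = c' w 1) → G c = G c')
        (κ : ℂ) (f₀ : Matrix (Fin 2) (Fin 2) ℂ → ℂ) (_ : Continuous f₀) (_ : HasCompactSupport f₀)
        (_ : ∀ v : Fin 3 → ℝ, φ w₀ v = κ *
          ∫ h : archLocal L 2 (Matrix.of fun i j : Fin 2 => if i.val + j.val + 1 = 2 then (1 : L) else 0) w₀,
            f₀ (((h * ⟨Matrix.GeneralLinearGroup.mkOfDetNeZero !![(1 : ℂ), 1; 1, -1] det_cayleyTwo_ne_zero *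
                  circleDiagonal 2 ![Circle.exp (v 0), Circle.exp (v 2)] *
                  (Matrix.GeneralLinearGroup.mkOfDetNeZero !![(1 : ℂ), 1; 1, -1] det_cayleyTwo_ne_zero)⁻¹,
                cayley_conj_circleDiagonal_mem_archLocal L w₀ _⟩ * h⁻¹ :
              archLocal L 2 (Matrix.of fun i j : Fin 2 => if i.val + j.val + 1 = 2 then (1 : L) else 0) w₀) : GL (Fin 2) ℂ) : Matrix (Fin 2) (Fin 2) ℂ) ∂ν₀),
        HasOneSidedJump (fun ν : ℝ => stOrbFamH L νH fH S (s + ν • nrm w₀))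
          (G s * (∏ w ∈ Finset.univ.erase w₀, (if w ∈ S then (((|Real.exp (s w 0) - Real.exp (-s w 0)| : ℝ) : ℂ) * φ w (s w))
              else (1 - (Circle.exp (s w 2 - s w 0) : ℂ)) * (φ w (s w) + φ w ![s w 2, s w 1, s w 0]))) *
            (κ * (2 * I * ((C₁ : ℂ) * ((∫ p in Ioi (0 : ℝ) ×ˢ Ioc (0 : ℝ) (2 * π),
                f₀ ((!![(1 : ℂ), 1; 1, -1] : Matrix (Fin 2) (Fin 2) ℂ) *
                  (((Circle.exp (s w₀ 0) : Circle) : ℂ) • (1 : Matrix (Fin 2) (Fin 2) ℂ) +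
                    p.1 • Matrix.diagonal ![((Circle.exp (s w₀ 0) : Circle) : ℂ) * I, -(((Circle.exp (s w₀ 0) : Circle) : ℂ) * I)] +
                    p.1 • !![(0 : ℂ), -(((Circle.exp (s w₀ 0) : Circle) : ℂ) * I) * cexp (-((p.2 : ℂ) * I));
                      (((Circle.exp (s w₀ 0) : Circle) : ℂ) * I) * cexp ((p.2 : ℂ) * I), 0]) *
                  !![(1 / 2 : ℂ), 1 / 2; 1 / 2, -(1 / 2)])) +
              ∫ p in Ioi (0 : ℝ) ×ˢ Ioc (0 : ℝ) (2 * π),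
                f₀ ((!![(1 : ℂ), 1; 1, -1] : Matrix (Fin 2) (Fin 2) ℂ) *
                  (((Circle.exp (s w₀ 0) : Circle) : ℂ) • (1 : Matrix (Fin 2) (Fin 2) ℂ) +
                    p.1 • Matrix.diagonal ![-(((Circle.exp (s w₀ 0) : Circle) : ℂ) * I), ((Circle.exp (s w₀ 0) : Circle) : ℂ) * I] +
                    p.1 • !![(0 : ℂ), (((Circle.exp (s w₀ 0) : Circle) : ℂ) * I) * cexp (-((p.2 : ℂ) * I));
                      -(((Circle.exp (s w₀ 0) : Circle) : ℂ) * I) * cexp ((p.2 : ℂ) * I), 0]) *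
                  !![(1 / 2 : ℂ), 1 / 2; 1 / 2, -(1 / 2)])))))) := by
  -- the stable doubling of the (K0±-Cayley) property: ★ p850182's shape for this `C₁`
  have hst : ∀ (f : Matrix (Fin 2) (Fin 2) ℂ → ℂ), Continuous f → HasCompactSupport f → ∀ z : Circle,
            HasOneSidedJump (fun t : ℝ => ((1 : ℂ) - cexp (-(2 * (t : ℂ) * I))) *
                ((∫ h : archLocal L 2 (Matrix.of fun i j : Fin 2 => if i.val + j.val + 1 = 2 then (1 : L) else 0) w₀,
                    f (((h * ⟨Matrix.GeneralLinearGroup.mkOfDetNeZero !![(1 : ℂ), 1; 1, -1] det_cayleyTwo_ne_zero *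
                          circleDiagonal 2 ![z * Circle.exp t, z * Circle.exp (-t)] *
                          (Matrix.GeneralLinearGroup.mkOfDetNeZero !![(1 : ℂ), 1; 1, -1] det_cayleyTwo_ne_zero)⁻¹,
                        cayley_conj_circleDiagonal_mem_archLocal L w₀ _⟩ * h⁻¹ :
                      archLocal L 2 (Matrix.of fun i j : Fin 2 => if i.val + j.val + 1 = 2 then (1 : L) else 0) w₀) : GL (Fin 2) ℂ) : Matrix (Fin 2) (Fin 2) ℂ) ∂ν₀) +
                 (∫ h : archLocal L 2 (Matrix.of fun i j : Fin 2 => if i.val + j.val + 1 = 2 then (1 : L) else 0) w₀,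
                    f (((h * ⟨Matrix.GeneralLinearGroup.mkOfDetNeZero !![(1 : ℂ), 1; 1, -1] det_cayleyTwo_ne_zero *
                          circleDiagonal 2 ![z * Circle.exp (-t), z * Circle.exp (-(-t))] *
                          (Matrix.GeneralLinearGroup.mkOfDetNeZero !![(1 : ℂ), 1; 1, -1] det_cayleyTwo_ne_zero)⁻¹,
                        cayley_conj_circleDiagonal_mem_archLocal L w₀ _⟩ * h⁻¹ :
                      archLocal L 2 (Matrix.of fun i j : Fin 2 => if i.val + j.val + 1 = 2 then (1 : L) else 0) w₀) : GL (Fin 2) ℂ) : Matrix (Fin 2) (Fin 2) ℂ) ∂ν₀)))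
              (2 * I * ((C₁ : ℂ) * ((∫ p in Ioi (0 : ℝ) ×ˢ Ioc (0 : ℝ) (2 * π),
                  f ((!![(1 : ℂ), 1; 1, -1] : Matrix (Fin 2) (Fin 2) ℂ) *
                    ((z : ℂ) • (1 : Matrix (Fin 2) (Fin 2) ℂ) + p.1 • Matrix.diagonal ![(z : ℂ) * I, -((z : ℂ) * I)] +
                      p.1 • !![(0 : ℂ), -((z : ℂ) * I) * cexp (-((p.2 : ℂ) * I)); ((z : ℂ) * I) * cexp ((p.2 : ℂ) * I), 0]) *
                    !![(1 / 2 : ℂ), 1 / 2; 1 / 2, -(1 / 2)])) +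
                ∫ p in Ioi (0 : ℝ) ×ˢ Ioc (0 : ℝ) (2 * π),
                  f ((!![(1 : ℂ), 1; 1, -1] : Matrix (Fin 2) (Fin 2) ℂ) *
                    ((z : ℂ) • (1 : Matrix (Fin 2) (Fin 2) ℂ) + p.1 • Matrix.diagonal ![-((z : ℂ) * I), (z : ℂ) * I] +
                      p.1 • !![(0 : ℂ), ((z : ℂ) * I) * cexp (-((p.2 : ℂ) * I)); -((z : ℂ) * I) * cexp ((p.2 : ℂ) * I), 0]) *
                    !![(1 / 2 : ℂ), 1 / 2; 1 / 2, -(1 / 2)])))) :=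
    fun f hf hfc z => Literature.NumberTheory.Automorphic.HasOneSidedJump.stableSum_of_two_sin_mul (hK0 f hf hfc z)
  intro fH S hw₀ s hs hreg hregS G φ hP hG1 κ f₀ hf₀ hf₀c hQ
  -- the `w₀`-factor: ★ p850182 at `z = e^{i s₀}`, scaled by the constant spectator product
  set z : Circle := Circle.exp (s w₀ 0) with hz
  set A : ℂ := G s * ∏ w ∈ Finset.univ.erase w₀, (if w ∈ S then (((|Real.exp (s w 0) - Real.exp (-s w 0)| : ℝ) : ℂ) * φ w (s w))
      else (1 - (Circle.exp (s w 2 - s w 0) : ℂ)) * (φ w (s w) + φ w ![s w 2, s w 1, s w 0])) with hA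
  have hjump := HasOneSidedJump.const_mul (A * κ) (hst f₀ hf₀ hf₀c z)
  -- flip invariance of `G` (it reads slot 1 only)
  have hG : ∀ T : Finset {w : InfinitePlace L // IsComplex w}, (∀ w ∈ T, w ∉ S) → ∀ c, G (flipSet T c) = G c := fun T _ c =>
    hG1 _ _ fun w => by rw [flipSet_apply]; split_ifs <;> simp
  -- on the punctured neighbourhood `0 < |ν| < 1` the family IS `A · κ · (stable normalised sum)`
  have key : ∀ ν ∈ Ioo (-1 : ℝ) 1, ν ≠ 0 → stOrbFamH L νH fH S (s + ν • nrm w₀) =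
      A * κ * (((1 : ℂ) - cexp (-(2 * (ν : ℂ) * I))) *
        ((∫ h : archLocal L 2 (Matrix.of fun i j : Fin 2 => if i.val + j.val + 1 = 2 then (1 : L) else 0) w₀,
            f₀ (((h * ⟨Matrix.GeneralLinearGroup.mkOfDetNeZero !![(1 : ℂ), 1; 1, -1] det_cayleyTwo_ne_zero *
                  circleDiagonal 2 ![z * Circle.exp ν, z * Circle.exp (-ν)] *
                  (Matrix.GeneralLinearGroup.mkOfDetNeZero !![(1 : ℂ), 1; 1, -1] det_cayleyTwo_ne_zero)⁻¹,
                cayley_conj_circleDiagonal_mem_archLocal L w₀ _⟩ * h⁻¹ :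
              archLocal L 2 (Matrix.of fun i j : Fin 2 => if i.val + j.val + 1 = 2 then (1 : L) else 0) w₀) : GL (Fin 2) ℂ) : Matrix (Fin 2) (Fin 2) ℂ) ∂ν₀) +
         (∫ h : archLocal L 2 (Matrix.of fun i j : Fin 2 => if i.val + j.val + 1 = 2 then (1 : L) else 0) w₀,
            f₀ (((h * ⟨Matrix.GeneralLinearGroup.mkOfDetNeZero !![(1 : ℂ), 1; 1, -1] det_cayleyTwo_ne_zero *
                  circleDiagonal 2 ![z * Circle.exp (-ν), z * Circle.exp (-(-ν))] *
                  (Matrix.GeneralLinearGroup.mkOfDetNeZero !![(1 : ℂ), 1; 1, -1] det_cayleyTwo_ne_zero)⁻¹,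
                cayley_conj_circleDiagonal_mem_archLocal L w₀ _⟩ * h⁻¹ :
              archLocal L 2 (Matrix.of fun i j : Fin 2 => if i.val + j.val + 1 = 2 then (1 : L) else 0) w₀) : GL (Fin 2) ℂ) : Matrix (Fin 2) (Fin 2) ℂ) ∂ν₀))) := by
    intro ν hν hν0
    have hc : s + ν • nrm w₀ ∈ RegS S := add_smul_nrm_mem_regS S hw₀ hs hreg hregS hν hν0
    rw [stOrbFamH_of_mem_regS L νH fH S hc, ← stableSum_def, archRH_mul_stableSum_eq_mul_prod S hP hG hc,
      ← Finset.mul_prod_erase Finset.univ _ (Finset.mem_univ w₀), if_neg hw₀]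
    -- the spectator factors and `G` are constant along the curve
    have hGs : G (s + ν • nrm w₀) = G s := hG1 _ _ fun w => add_smul_nrm_apply_one s ν w₀ w
    have hspec : ∏ w ∈ Finset.univ.erase w₀, (if w ∈ S then (((|Real.exp ((s + ν • nrm w₀) w 0) - Real.exp (-(s + ν • nrm w₀) w 0)| : ℝ) : ℂ) * φ w ((s + ν • nrm w₀) w))
        else (1 - (Circle.exp ((s + ν • nrm w₀) w 2 - (s + ν • nrm w₀) w 0) : ℂ)) * (φ w ((s + ν • nrm w₀) w) + φ w ![(s + ν • nrm w₀) w 2, (s + ν • nrm w₀) w 1, (s + ν • nrm w₀) w 0])) =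
        ∏ w ∈ Finset.univ.erase w₀, (if w ∈ S then (((|Real.exp (s w 0) - Real.exp (-s w 0)| : ℝ) : ℂ) * φ w (s w))
        else (1 - (Circle.exp (s w 2 - s w 0) : ℂ)) * (φ w (s w) + φ w ![s w 2, s w 1, s w 0])) :=
      Finset.prod_congr rfl fun w hw => by rw [add_smul_nrm_apply_of_ne s ν (Finset.ne_of_mem_erase hw)]
    rw [hGs, hspec]
    -- the `w₀`-factor through `hQ` and the Cayley-torus angles
    have h0 : Circle.exp ((s + ν • nrm w₀) w₀ 0) = z * Circle.exp ν := circleExp_add_smul_nrm₀ s ν w₀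
    have h2 : Circle.exp ((s + ν • nrm w₀) w₀ 2) = z * Circle.exp (-ν) := circleExp_add_smul_nrm₂ s ν w₀ hs
    have hflip0 : Circle.exp ((![(s + ν • nrm w₀) w₀ 2, (s + ν • nrm w₀) w₀ 1, (s + ν • nrm w₀) w₀ 0] : Fin 3 → ℝ) 0) = z * Circle.exp (-ν) := by
      simp only [Matrix.cons_val_zero]; exact h2
    have hflip2 : Circle.exp ((![(s + ν • nrm w₀) w₀ 2, (s + ν • nrm w₀) w₀ 1, (s + ν • nrm w₀) w₀ 0] : Fin 3 → ℝ) 2) = z * Circle.exp (-(-ν)) := by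
      simp only [Matrix.cons_val_two, Matrix.tail_cons, Matrix.head_cons, neg_neg]; exact h0
    -- the integral as a function of the two circle angles
    have hI : ∀ (a b a' b' : Circle), a = a' → b = b' →
        (∫ h : archLocal L 2 (Matrix.of fun i j : Fin 2 => if i.val + j.val + 1 = 2 then (1 : L) else 0) w₀,
            f₀ (((h * ⟨Matrix.GeneralLinearGroup.mkOfDetNeZero !![(1 : ℂ), 1; 1, -1] det_cayleyTwo_ne_zero * circleDiagonal 2 ![a, b] *
                  (Matrix.GeneralLinearGroup.mkOfDetNeZero !![(1 : ℂ), 1; 1, -1] det_cayleyTwo_ne_zero)⁻¹,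
                cayley_conj_circleDiagonal_mem_archLocal L w₀ _⟩ * h⁻¹ :
              archLocal L 2 (Matrix.of fun i j : Fin 2 => if i.val + j.val + 1 = 2 then (1 : L) else 0) w₀) : GL (Fin 2) ℂ) : Matrix (Fin 2) (Fin 2) ℂ) ∂ν₀) =
        (∫ h : archLocal L 2 (Matrix.of fun i j : Fin 2 => if i.val + j.val + 1 = 2 then (1 : L) else 0) w₀,
            f₀ (((h * ⟨Matrix.GeneralLinearGroup.mkOfDetNeZero !![(1 : ℂ), 1; 1, -1] det_cayleyTwo_ne_zero * circleDiagonal 2 ![a', b'] *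
                  (Matrix.GeneralLinearGroup.mkOfDetNeZero !![(1 : ℂ), 1; 1, -1] det_cayleyTwo_ne_zero)⁻¹,
                cayley_conj_circleDiagonal_mem_archLocal L w₀ _⟩ * h⁻¹ :
              archLocal L 2 (Matrix.of fun i j : Fin 2 => if i.val + j.val + 1 = 2 then (1 : L) else 0) w₀) : GL (Fin 2) ℂ) : Matrix (Fin 2) (Fin 2) ℂ) ∂ν₀) := by
      rintro a b a' b' rfl rfl; rfl
    rw [hQ, hQ, hI _ _ _ _ h0 h2, hI _ _ _ _ hflip0 hflip2, one_sub_circleExp_add_smul_nrm s ν w₀ hs, hA]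
    ring
  -- transfer the jump of ★ p850182 along the eventual equality on both punctured sides
  have hres := HasOneSidedJump.congr_nhdsWithin hjump
    (by filter_upwards [Ioo_mem_nhdsGT (zero_lt_one' ℝ)] with ν hν
        exact key ν ⟨by linarith [hν.1], hν.2⟩ hν.1.ne')
    (by filter_upwards [Ioo_mem_nhdsLT (show (-1 : ℝ) < 0 by norm_num)] with ν hν
        exact key ν ⟨hν.1, by linarith [hν.2]⟩ hν.2.ne)
  exact HasOneSidedJump.jump_congr hres (mul_assoc _ _ _)

end JumpBinder

/-! ## §2 The product-road jump value with `C₁` as a binder (twin of ★ p850334 §2) -/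

section ProductJumpBinder

open scoped Classical

variable (L : Type) [Field L] [NumberField L] [IsCMField L]
  [∀ w : {w : InfinitePlace L // IsComplex w}, MeasurableSpace ↥(archLocal L 2 (Matrix.of fun i j : Fin 2 => if i.val + j.val + 1 = 2 then (1 : L) else 0) w)]
  [∀ w : {w : InfinitePlace L // IsComplex w}, BorelSpace ↥(archLocal L 2 (Matrix.of fun i j : Fin 2 => if i.val + j.val + 1 = 2 then (1 : L) else 0) w)]
  [MeasurableSpace ↥(arch (↥(maximalRealSubfield L)) L (IsCMField.complexConj L) 2 (Matrix.of fun i j : Fin 2 => if i.val + j.val + 1 = 2 then (1 : L) else 0))]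
  [BorelSpace ↥(arch (↥(maximalRealSubfield L)) L (IsCMField.complexConj L) 2 (Matrix.of fun i j : Fin 2 => if i.val + j.val + 1 = 2 then (1 : L) else 0))]
  [MeasurableSpace ↥(arch (↥(maximalRealSubfield L)) L (IsCMField.complexConj L) 1 (Matrix.of fun i j : Fin 1 => if i.val + j.val + 1 = 1 then (1 : L) else 0))]
  [BorelSpace ↥(arch (↥(maximalRealSubfield L)) L (IsCMField.complexConj L) 1 (Matrix.of fun i j : Fin 1 => if i.val + j.val + 1 = 1 then (1 : L) else 0))]
  (νw : ∀ w : {w : InfinitePlace L // IsComplex w}, Measure ↥(archLocal L 2 (Matrix.of fun i j : Fin 2 => if i.val + j.val + 1 = 2 then (1 : L) else 0) w))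
  [∀ w, (νw w).IsHaarMeasure] [∀ w, (νw w).IsMulRightInvariant]
  (νB : Measure ↥(arch (↥(maximalRealSubfield L)) L (IsCMField.complexConj L) 1 (Matrix.of fun i j : Fin 1 => if i.val + j.val + 1 = 1 then (1 : L) else 0)))
  [νB.IsHaarMeasure] [νB.IsMulRightInvariant]
  (νH : Measure (↥(arch (↥(maximalRealSubfield L)) L (IsCMField.complexConj L) 2 (Matrix.of fun i j : Fin 2 => if i.val + j.val + 1 = 2 then (1 : L) else 0)) ×
      ↥(arch (↥(maximalRealSubfield L)) L (IsCMField.complexConj L) 1 (Matrix.of fun i j : Fin 1 => if i.val + j.val + 1 = 1 then (1 : L) else 0))))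
  [νH.IsHaarMeasure] [νH.IsMulRightInvariant]
  (hν : νH = ((Measure.pi νw).map (archPiEquivCM 2 L (Matrix.of fun i j : Fin 2 => if i.val + j.val + 1 = 2 then (1 : L) else 0)).symm).prod νB)
  (w₀ : {w : InfinitePlace L // IsComplex w})


include hν in
/-- **(J-H) ORDER 0 ON PRODUCT TEST FUNCTIONS, `C₁` AS A BINDER.**  For every real `C₁` with the (K0±-Cayley) jump property at `(w₀, ν_{w₀})` and every product test function
`fH (a, b) = (∏_w f_w((eA a)_w)) · g b` with `f_{w₀} = f₀ ∘ coe`, `f₀ ∈ C_c(M₂(ℂ))`, at every semiregular wall point `s` of `S ∌ w₀` the genuine stable family along the normal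
curve JUMPS BY `ν_B(B) · g((endoTorus S s).2) · (∏_{w ≠ w₀} L_w[chartOrbHLoc L S w ν_w f_w](s w)) · 2i · C₁ · [cone⁺ + cone⁻](f₀, e^{i s₀})` — ★ p850334 §2 with the constant named
((P1) ★ `chartOrbH_eq_prod_chartOrbHLoc`, (P4) ★ `chartOrbHLoc_eq_integral_of_not_mem`, `κ = 1`). [cite: Shelstad1979, Lemma 4.3 p. 25; Thm. 4.7 (IIIb) p. 31]
[cite: Bouaziz1994IntegralesOrbitales, §3.2 (I₃) p. 580; §6.2 p. 591] [cite: Rogawski1990, §8.2 pp. 119, 122; §8.3 p. 124] [cite: BorelJacquet1979, §4.1] -/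
theorem hasOneSidedJump_stOrbFamH_add_smul_nrm_prod_of_cayleyJump (C₁ : ℝ)
    (hK0 : ∀ (f : Matrix (Fin 2) (Fin 2) ℂ → ℂ), Continuous f → HasCompactSupport f → ∀ z : Circle,
          HasOneSidedJump (fun ψ : ℝ => (2 * Real.sin ψ : ℂ) *
              ∫ h : archLocal L 2 (Matrix.of fun i j : Fin 2 => if i.val + j.val + 1 = 2 then (1 : L) else 0) w₀,
                f (((h * ⟨Matrix.GeneralLinearGroup.mkOfDetNeZero !![(1 : ℂ), 1; 1, -1] det_cayleyTwo_ne_zero *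
                      circleDiagonal 2 ![z * Circle.exp ψ, z * Circle.exp (-ψ)] *
                      (Matrix.GeneralLinearGroup.mkOfDetNeZero !![(1 : ℂ), 1; 1, -1] det_cayleyTwo_ne_zero)⁻¹,
                    cayley_conj_circleDiagonal_mem_archLocal L w₀ _⟩ * h⁻¹ :
                  archLocal L 2 (Matrix.of fun i j : Fin 2 => if i.val + j.val + 1 = 2 then (1 : L) else 0) w₀) : GL (Fin 2) ℂ) : Matrix (Fin 2) (Fin 2) ℂ) ∂(νw w₀))
            ((C₁ : ℂ) * ((∫ p in Ioi (0 : ℝ) ×ˢ Ioc (0 : ℝ) (2 * π),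
                f ((!![(1 : ℂ), 1; 1, -1] : Matrix (Fin 2) (Fin 2) ℂ) *
                  ((z : ℂ) • (1 : Matrix (Fin 2) (Fin 2) ℂ) + p.1 • Matrix.diagonal ![(z : ℂ) * I, -((z : ℂ) * I)] +
                    p.1 • !![(0 : ℂ), -((z : ℂ) * I) * cexp (-((p.2 : ℂ) * I)); ((z : ℂ) * I) * cexp ((p.2 : ℂ) * I), 0]) *
                  !![(1 / 2 : ℂ), 1 / 2; 1 / 2, -(1 / 2)])) +
              ∫ p in Ioi (0 : ℝ) ×ˢ Ioc (0 : ℝ) (2 * π),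
                f ((!![(1 : ℂ), 1; 1, -1] : Matrix (Fin 2) (Fin 2) ℂ) *
                  ((z : ℂ) • (1 : Matrix (Fin 2) (Fin 2) ℂ) + p.1 • Matrix.diagonal ![-((z : ℂ) * I), (z : ℂ) * I] +
                    p.1 • !![(0 : ℂ), ((z : ℂ) * I) * cexp (-((p.2 : ℂ) * I)); -((z : ℂ) * I) * cexp ((p.2 : ℂ) * I), 0]) *
                  !![(1 / 2 : ℂ), 1 / 2; 1 / 2, -(1 / 2)])))) :
      ∀ (fH : ↥(arch (↥(maximalRealSubfield L)) L (IsCMField.complexConj L) 2 (Matrix.of fun i j : Fin 2 => if i.val + j.val + 1 = 2 then (1 : L) else 0)) ×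
          ↥(arch (↥(maximalRealSubfield L)) L (IsCMField.complexConj L) 1 (Matrix.of fun i j : Fin 1 => if i.val + j.val + 1 = 1 then (1 : L) else 0)) → ℂ)
        (f : ∀ w : {w : InfinitePlace L // IsComplex w}, ↥(archLocal L 2 (Matrix.of fun i j : Fin 2 => if i.val + j.val + 1 = 2 then (1 : L) else 0) w) → ℂ)
        (g : ↥(arch (↥(maximalRealSubfield L)) L (IsCMField.complexConj L) 1 (Matrix.of fun i j : Fin 1 => if i.val + j.val + 1 = 1 then (1 : L) else 0)) → ℂ)
        (_ : ∀ a b, fH (a, b) = (∏ w, f w (archPiEquivCM 2 L (Matrix.of fun i j : Fin 2 => if i.val + j.val + 1 = 2 then (1 : L) else 0) a w)) * g b)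
        (f₀ : Matrix (Fin 2) (Fin 2) ℂ → ℂ) (_ : Continuous f₀) (_ : HasCompactSupport f₀)
        (_ : ∀ x : ↥(archLocal L 2 (Matrix.of fun i j : Fin 2 => if i.val + j.val + 1 = 2 then (1 : L) else 0) w₀), f w₀ x = f₀ ((x : GL (Fin 2) ℂ) : Matrix (Fin 2) (Fin 2) ℂ))
        (S : Finset {w : InfinitePlace L // IsComplex w}) (_ : w₀ ∉ S)
        (s : {w : InfinitePlace L // IsComplex w} → Fin 3 → ℝ) (_ : s w₀ 0 = s w₀ 2)
        (_ : ∀ w, w ∉ S → w ≠ w₀ → Circle.exp (s w 0) ≠ Circle.exp (s w 2)) (_ : ∀ w ∈ S, s w 0 ≠ 0),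
        HasOneSidedJump (fun ν : ℝ => stOrbFamH L νH fH S (s + ν • nrm w₀))
          ((νB.real Set.univ : ℂ) * g (endoTorus L S s).2 *
            (∏ w ∈ Finset.univ.erase w₀, (if w ∈ S then (((|Real.exp (s w 0) - Real.exp (-s w 0)| : ℝ) : ℂ) * chartOrbHLoc L S w (νw w) (f w) (s w))
              else (1 - (Circle.exp (s w 2 - s w 0) : ℂ)) * (chartOrbHLoc L S w (νw w) (f w) (s w) + chartOrbHLoc L S w (νw w) (f w) ![s w 2, s w 1, s w 0]))) *
            (2 * I * ((C₁ : ℂ) * ((∫ p in Ioi (0 : ℝ) ×ˢ Ioc (0 : ℝ) (2 * π),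
                f₀ ((!![(1 : ℂ), 1; 1, -1] : Matrix (Fin 2) (Fin 2) ℂ) *
                  (((Circle.exp (s w₀ 0) : Circle) : ℂ) • (1 : Matrix (Fin 2) (Fin 2) ℂ) +
                    p.1 • Matrix.diagonal ![((Circle.exp (s w₀ 0) : Circle) : ℂ) * I, -(((Circle.exp (s w₀ 0) : Circle) : ℂ) * I)] +
                    p.1 • !![(0 : ℂ), -(((Circle.exp (s w₀ 0) : Circle) : ℂ) * I) * cexp (-((p.2 : ℂ) * I));
                      (((Circle.exp (s w₀ 0) : Circle) : ℂ) * I) * cexp ((p.2 : ℂ) * I), 0]) *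
                  !![(1 / 2 : ℂ), 1 / 2; 1 / 2, -(1 / 2)])) +
              ∫ p in Ioi (0 : ℝ) ×ˢ Ioc (0 : ℝ) (2 * π),
                f₀ ((!![(1 : ℂ), 1; 1, -1] : Matrix (Fin 2) (Fin 2) ℂ) *
                  (((Circle.exp (s w₀ 0) : Circle) : ℂ) • (1 : Matrix (Fin 2) (Fin 2) ℂ) +
                    p.1 • Matrix.diagonal ![-(((Circle.exp (s w₀ 0) : Circle) : ℂ) * I), ((Circle.exp (s w₀ 0) : Circle) : ℂ) * I] +
                    p.1 • !![(0 : ℂ), (((Circle.exp (s w₀ 0) : Circle) : ℂ) * I) * cexp (-((p.2 : ℂ) * I));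
                      -(((Circle.exp (s w₀ 0) : Circle) : ℂ) * I) * cexp ((p.2 : ℂ) * I), 0]) *
                  !![(1 / 2 : ℂ), 1 / 2; 1 / 2, -(1 / 2)]))))) := by
  intro fH f g hfH f₀ hf₀ hf₀c hfw₀ S hw₀ s hs hreg hregS
  have hJ := hasOneSidedJump_stOrbFamH_add_smul_nrm_of_cayleyJump L νH w₀ (νw w₀) C₁ hK0
  -- the `w₀`-factor is Borel measurable (it is the restriction of the continuous `f₀`)
  have hmeas : Measurable (f w₀) := by
    have e : f w₀ = fun x : ↥(archLocal L 2 (Matrix.of fun i j : Fin 2 => if i.val + j.val + 1 = 2 then (1 : L) else 0) w₀) =>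
        f₀ ((x : GL (Fin 2) ℂ) : Matrix (Fin 2) (Fin 2) ℂ) := funext hfw₀
    rw [e]
    exact (hf₀.comp (Units.continuous_val.comp continuous_subtype_val)).measurable
  -- at the compact place `w₀ ∉ S` the local chart point IS the Cayley-torus element of ★ p850206's `hQ`
  have hE : ∀ v : Fin 3 → ℝ, endoBlockAt L S w₀ v =
      ⟨Matrix.GeneralLinearGroup.mkOfDetNeZero !![(1 : ℂ), 1; 1, -1] det_cayleyTwo_ne_zero * circleDiagonal 2 ![Circle.exp (v 0), Circle.exp (v 2)] *
          (Matrix.GeneralLinearGroup.mkOfDetNeZero !![(1 : ℂ), 1; 1, -1] det_cayleyTwo_ne_zero)⁻¹,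
        cayley_conj_circleDiagonal_mem_archLocal L w₀ _⟩ :=
    fun v => Subtype.ext (coe_endoBlock_eq_cayley_of_not_mem L S (fun _ => v) hw₀)
  have h := hJ fH S hw₀ s hs hreg hregS (fun c => (νB.real Set.univ : ℂ) * g (endoTorus L S c).2) (fun w v => chartOrbHLoc L S w (νw w) (f w) v)
    (fun c _ => chartOrbH_eq_prod_chartOrbHLoc L S νw νB νH hν fH f g hfH c)
    (fun c c' hc => by rw [endoTorus_snd_eq_of_forall_apply_one L S S hc])
    1 f₀ hf₀ hf₀c (fun v => by
      rw [one_mul, chartOrbHLoc_eq_integral_of_not_mem L S w₀ (νw w₀) hw₀ (f w₀) hmeas v, hE v]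
      simp_rw [hfw₀])
  simpa only [one_mul] using h

end ProductJumpBinder

end Literature.NumberTheory.Rogawski1990

end
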